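import Summits.QuantumFields.YangMills.Theorems.BalabanUVNodesN11NoExpansionNumerics
import Literature.MathematicalPhysics.QuantumFieldTheory.Balaban1983to89.Node00.Record13NumericsOfThm1CCMW

/-!
# DAG node N11 — THE NUMERIC ROWS OF THE NO-EXPANSION 𝐓-STEP AT K1's WITNESS OF RECORD `θ₁₅ᶜᶜᴹᵂ(j; γ)` (and at every parameter with its numerics SHAPE
# `M₁ = L^j`, `M₂ = r = p₀ = 1`, `0 < A₀ ≤ 1∕16`): they hold on every windowed run AS SOON AS THE WINDOW LETTER `γ` IS SMALL — four explicit scalar conditions on `γ`,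
# met on an explicit interval `]0, γ₁₁ⁿᵘᵐ(L, j, N)]` — LOCATED: only `2 ≤ cR` (there `cR = 1`) is not a matter of `γ`

HEADER — WORK-UNIT METADATA.  Cell `pub-ymgap`, YM-PLAN Track A (HUMAN RULING D-0062 ∕ D-0149 width seats), seat `pub-ymgap-dag-n11-w3` (g3; WIDTH SEAT 3∕4 on NODE n11 [B14],
director-ym №197), route `BalabanUVNodes` (v1.7 `CoPH` key), item K1⁷ `StabilityBAtRecordR13SepCoPH` = stmt-QuantumFields-20542 (helper lane `--kind proof --supports 20542
--as helper`, count-neutral).  Sequel of this seat's p605914 `…N11NoExpansionNumerics` (dag-n11-d g13's hand-out «numerics hygiene»: the five per-level numeric rows `h3 hR hε hε3 hε2`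
of the ZhPin-class no-expansion 𝐓-step faces p604229 ∕ p605244 from scalars on `(θ.ν, L, θ.γ, N)`), read at dag-n21-c's WINDOW-LETTERED [15]-WITNESS `theta13OfThm1CCMW F N j γ ε₀ ε₂₉
B₃ B₃' a₀ a₁` (`Node00/Record13NumericsOfThm1CCMW`: `M = M₁ = L^j`, `M₂ = r = p₀ = 1`, `A₀ = A₀ᶜᶜ¹(L; B₃, B₃′, a₀, a₁)`, `cR = 1`, window `γ` a LETTER) — the Stage-13 part of K1⁷'s
witness of record `θ₁₅ᶜᶜᴹᵂ(j; γ)` (dag-n24-c ∕ dag-n24-w1's closing forms; dag-n11-e g19's INTENT-1 §2∕§3).  [III] = [Balaban1988Convergent], [15] = [Balaban1985Variational], [B7] =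
[Balaban1985Averaging], [I] = [Balaban1987RG1].

WHY THIS FILE.  K1⁷'s closing form hands N11 a window letter (`… ∃ γ₁₁ > 0, ∀ w, … w.γ ≤ γ₁₁ → …`, dag-n24-w1's `h11F`), and after p605914 the numeric rows of N11's no-expansion 𝐓-step
are scalar conditions on `(θ.ν, L, θ.γ, N)`.  At the numerics SHAPE of `θ₁₅ᶜᶜᴹᵂ(j; γ)` — `M₁ = L^j`, `M₂ = 1`, `r = 1`, `p₀ = 1`, `0 < A₀ ≤ 1∕16` — the `M₂`-light (log) forms and
the edge forms of p605914 turn the five rows into FOUR CONDITIONS ON THE WINDOW LETTER ALONE: `3·L^j ≤ L·log γ⁻²` (`h3`), `8L + 3 ≤ L·log γ⁻²` (`hR`), `γ ≤ e^{−1}` with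
`36608·γ·log γ⁻² ≤ 16∕3` (`hε3`) and `γ·log γ⁻² ≤ 16·δ_N∕(8L)²` (`hε2`) (`hε` needs only `γ < 1`); and since `γ·log γ⁻² ≤ 4√γ`, all four hold on the explicit interval
`]0, γ₁₁ⁿᵘᵐ]`, `γ₁₁ⁿᵘᵐ(L, j, N) := min (e^{−(3L^j + 8L + 3)}) ((c∕4)²)`, `c := min (16∕(3·36608)) (16·δ_N∕(8L)²)`.  So «γ sufficiently small» for N11's numerics at K1's witness is
QUANTIFIED; the one row that is NOT a matter of γ is `2 ≤ cR` (`cR = 1` at every K0a witness — dag-n11-d g12's LOCATED, repeated here as a `decide`-free remark, not re-proved).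

WHAT THIS FILE PROVES (0 `def`, 0 `sorry`, standard axioms).
§1 SCALAR: `mul_log_inv_sq_le_four_sqrt` (`γ·log γ⁻² ≤ 4√γ`, `γ > 0`) · `A0OfThm1_le_half` · `A0OfThm1CC1_le_one_div_sixteen` · ★ `exists_window_ccmShape` (the explicit `γ₁₁ⁿᵘᵐ(L, j, N)` and
   the four conditions on `]0, γ₁₁ⁿᵘᵐ]`).
§2 THE FIVE ROWS AT THE SHAPE (generic `θ : Stage13HParams F N` with `θ.ν.M₁ = L^j`, `θ.ν.M₂ = 1`, `θ.ν.r = 1`, `θ.ν.p₀ = 1`, `0 < θ.ν.A₀ ≤ 1∕16`; conclusions VERBATIM the five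
   binders of p604229): `h3_of_ccmShape` · `hR_of_ccmShape` · `hε3_of_ccmShape` · `hε2_of_ccmShape` (`hε` is p605914's `hε_of_window` verbatim).
§3 AT THE H-EXTENSIONS `⟨⟨θ₁₅ᶜᶜᴹᵂ(j; γ), Zr⟩, Zh, Phih⟩` OF K1's WITNESS (every field of the shape `rfl`; `0 < A₀ᶜᶜ¹ ≤ 1∕16` from the [15] signs): ★★ `numericRows_theta13OfThm1CCMWH`
   (the five rows, every windowed run, every level, from the four γ-conditions) · ★★★ `exists_window_numericRows_theta13OfThm1CCMWH` (∃ `γ₁₁ⁿᵘᵐ > 0` such that for EVERY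
   `γ ∈ ]0, γ₁₁ⁿᵘᵐ]` the five rows hold at `θ₁₅ᶜᶜᴹᵂ(j; γ)` on every run in the window `]0, γ]`, every level).

HONEST FRAMING.  Helper lane, count-neutral KERNEL BOOKKEEPING (real-variable inequalities at displayed numerals); nothing of Bałaban ([III] ∕ [15] ∕ [B7] ∕ [I]) is asserted; the
numerals are node00-def-K0a ∕ dag-n21-c's displayed choices, not Bałaban's constants; K0's analysis rows (`Provisos₁₃SepCoPH`, per-cube [15]-solvability, the cube cover), the
record rows and `2 ≤ cR` are untouched — and `2 ≤ cR` FAILS at `θ₁₅ᶜᶜᴹᵂ` (`cR = 1`), so this file does NOT make dag-n11-d's faces applicable there; it settles the numeric rows only.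
N11 NOT discharged; K1⁷ NOT closed; counts unmoved (typed 28∕28 · discharged 5∕27).  One finite `𝕋⁴_{L^K}` programme at fixed `ε = L^{−K}`; R4 closes only the conditional
finite-𝕋⁴ rung `BalabanLadder.UV` — NOT ℝ⁴, NOT OS, NOT a mass gap, NOT Clay.  No `sorry`, no `axiom`, no `def`, no `instance`, no `notation`.
Sources (SHAPE only): [III] (2.4)–(2.5) p.255, (2.13) pp.256–257, (2.17) p.257; [B7] Prop. 2 p.26; [I] Thm 1 p.259 (the window); [15] Thm 1 (7)–(10) p.279 (the signs of `B₃, a₀, a₁`).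
-/

noncomputable section

open scoped BigOperators

namespace Summit.QuantumFields.YangMills.Theorems.BalabanUVNodesN11NoExpansionNumericsAtThm1CCMW

open Literature.MathematicalPhysics.QuantumFieldTheory.Balaban1983to89 T4Continuum Node00
open B14.Eq213MaximalDomains (side)
open B14FlowStep (log_inv_sq log_inv_sq_mono log_inv_sq_nonneg)
open BalabanUVNodesN11NoExpansionNumerics

/-! ## §1  Scalars: `γ·log γ⁻² ≤ 4√γ`, `A₀ᶜᶜ¹ ≤ 1∕16`, and the explicit window `γ₁₁ⁿᵘᵐ(L, j, N)` -/

section Scalar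

/-- **`γ·log γ⁻² ≤ 4√γ`** for `γ > 0` (`log γ⁻² = 4·log(1∕√γ) ≤ 4·(1∕√γ − 1)`). [cite: Balaban1988Convergent, (2.4) p.255 (bookkeeping)] -/
theorem mul_log_inv_sq_le_four_sqrt {γ : ℝ} (hγ : 0 < γ) : γ * Real.log (γ ^ 2)⁻¹ ≤ 4 * Real.sqrt γ := by
  have hs : 0 < Real.sqrt γ := Real.sqrt_pos.mpr hγ
  have hlog : Real.log (γ ^ 2)⁻¹ = 4 * Real.log (Real.sqrt γ)⁻¹ := by
    rw [log_inv_sq, Real.log_inv, Real.log_sqrt hγ.le]; ring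
  have h1 : Real.log (Real.sqrt γ)⁻¹ ≤ (Real.sqrt γ)⁻¹ - 1 := Real.log_le_sub_one_of_pos (inv_pos.mpr hs)
  have h2 : γ * (Real.sqrt γ)⁻¹ = Real.sqrt γ := by
    rw [← div_eq_mul_inv, Real.div_sqrt]
  calc γ * Real.log (γ ^ 2)⁻¹ = 4 * (γ * Real.log (Real.sqrt γ)⁻¹) := by rw [hlog]; ring
    _ ≤ 4 * (γ * ((Real.sqrt γ)⁻¹ - 1)) := by gcongr
    _ = 4 * Real.sqrt γ - 4 * γ := by rw [mul_sub, h2]; ring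
    _ ≤ 4 * Real.sqrt γ := by linarith

variable {L : ℕ} {B₃ B₃' a₀ a₁ : ℝ}

/-- `A₀(B₃, a₀, a₁) = min(a₁, a₀, ½)∕(1 + B₃) ≤ ½` for `B₃ ≥ 0`. [cite: Balaban1988Convergent, (2.4) p.255 (bookkeeping of a displayed numeral)] -/
theorem A0OfThm1_le_half (hB : 0 ≤ B₃) : A0OfThm1 B₃ a₀ a₁ ≤ 1 / 2 := by
  unfold A0OfThm1
  have h1 : min a₁ (min a₀ (1 / 2)) ≤ 1 / 2 := (min_le_right _ _).trans (min_le_right _ _)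
  calc min a₁ (min a₀ (1 / 2)) / (1 + B₃) ≤ (1 / 2) / (1 + B₃) := div_le_div_of_nonneg_right h1 (by positivity)
    _ ≤ (1 / 2) / 1 := div_le_div_of_nonneg_left (by norm_num) one_pos (by linarith)
    _ = 1 / 2 := by norm_num

/-- **`A₀ᶜᶜ¹ ≤ 1∕16`** (`A₀ᶜᶜ¹ ≤ A₀ᶜ = A₀∕8 ≤ 1∕16`) under [15]'s signs. [cite: Balaban1988Convergent, (2.4) p.255; Balaban1985Variational, (7) p.278, Thm 1 (8)–(10) p.279 (bookkeeping of a displayed numeral)] -/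
theorem A0OfThm1CC1_le_one_div_sixteen (hB : 0 ≤ B₃) (hB' : 0 ≤ B₃') (ha₀ : 0 ≤ a₀) (ha₁ : 0 ≤ a₁) : A0OfThm1CC1 L B₃ B₃' a₀ a₁ ≤ 1 / 16 := by
  refine (A0OfThm1CC1_le hB hB' ha₀ ha₁).trans ?_
  unfold A0OfThm1C
  have := A0OfThm1_le_half (a₀ := a₀) (a₁ := a₁) hB
  linarith

/-- **★ THE EXPLICIT WINDOW `γ₁₁ⁿᵘᵐ(L, j, N) := min (e^{−(3L^j + 8L + 3)}) ((c∕4)²)`, `c := min (16∕(3·36608)) (16δ_N∕(8L)²)`**: for every `γ ∈ ]0, γ₁₁ⁿᵘᵐ]` the four γ-conditions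
of the numeric rows at the CCM shape hold — `γ ≤ e^{−1}`, `3·L^j ≤ L·log γ⁻²`, `8L + 3 ≤ L·log γ⁻²`, `36608·γ·log γ⁻² ≤ 16∕3`, `γ·log γ⁻² ≤ 16·δ_N∕(8L)²` (`L ≥ 1`).
[cite: Balaban1988Convergent, (2.4)–(2.5) p.255; Balaban1987RG1, Thm 1 p.259 («γ sufficiently small», quantified for these rows)] -/
theorem exists_window_ccmShape (hL : 1 ≤ L) (j N : ℕ) [NeZero N] :
    ∃ γ₀ : ℝ, 0 < γ₀ ∧ ∀ γ : ℝ, 0 < γ → γ ≤ γ₀ →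
      γ ≤ Real.exp (-1) ∧ 3 * (L : ℝ) ^ j ≤ L * Real.log (γ ^ 2)⁻¹ ∧ ((8 * L + 3 : ℕ) : ℝ) ≤ L * Real.log (γ ^ 2)⁻¹ ∧
        36608 * (γ * Real.log (γ ^ 2)⁻¹) ≤ 16 / 3 ∧ γ * Real.log (γ ^ 2)⁻¹ ≤ 16 * ExpMeanLog.deltaSU (Fin N) / ((8 * L : ℕ) : ℝ) ^ 2 := by
  set A : ℝ := 3 * (L : ℝ) ^ j + 8 * L + 3 with hA
  set c : ℝ := min (16 / (3 * 36608)) (16 * ExpMeanLog.deltaSU (Fin N) / ((8 * L : ℕ) : ℝ) ^ 2) with hc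
  have hL' : (1 : ℝ) ≤ L := by exact_mod_cast hL
  have hδ : 0 < ExpMeanLog.deltaSU (Fin N) := ExpMeanLog.deltaSU_pos
  have hc0 : 0 < c := lt_min (by norm_num) (by positivity)
  have hLj : (0 : ℝ) ≤ 3 * (L : ℝ) ^ j := by positivity
  have hA1 : 1 ≤ A := by rw [hA]; linarith
  refine ⟨min (Real.exp (-A)) ((c / 4) ^ 2), lt_min (Real.exp_pos _) (by positivity), fun γ hγ hγle => ?_⟩
  have hγA : γ ≤ Real.exp (-A) := hγle.trans (min_le_left _ _)
  have hγc : γ ≤ (c / 4) ^ 2 := hγle.trans (min_le_right _ _)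
  -- `log γ⁻² ≥ 2A`
  have hlog : 2 * A ≤ Real.log (γ ^ 2)⁻¹ := by
    rw [log_inv_sq]
    have : Real.log γ ≤ -A := (Real.log_le_iff_le_exp hγ).mpr hγA
    linarith
  have hLlog : 2 * A ≤ L * Real.log (γ ^ 2)⁻¹ :=
    hlog.trans (le_mul_of_one_le_left (by linarith) hL')
  -- `γ·log γ⁻² ≤ c`
  have hγlog : γ * Real.log (γ ^ 2)⁻¹ ≤ c := by
    have h4 : Real.sqrt γ ≤ c / 4 := by
      rw [Real.sqrt_le_left (by positivity)]; exact hγc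
    linarith [mul_log_inv_sq_le_four_sqrt hγ]
  refine ⟨hγA.trans (Real.exp_le_exp.mpr (by linarith)), ?_, ?_, ?_, ?_⟩
  · have : 3 * (L : ℝ) ^ j ≤ 2 * A := by rw [hA]; nlinarith
    exact this.trans hLlog
  · have : ((8 * L + 3 : ℕ) : ℝ) ≤ 2 * A := by rw [hA]; push_cast; nlinarith
    exact this.trans hLlog
  · calc 36608 * (γ * Real.log (γ ^ 2)⁻¹) ≤ 36608 * c := by gcongr
      _ ≤ 36608 * (16 / (3 * 36608)) := by gcongr; exact min_le_left _ _
      _ = 16 / 3 := by norm_num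
  · exact hγlog.trans (min_le_right _ _)

end Scalar

/-! ## §2  The rows at the CCM numerics SHAPE (`M₁ = L^j`, `M₂ = r = p₀ = 1`, `0 < A₀ ≤ 1∕16`) from the four γ-conditions -/

section Shape

variable {F : T4Family} {N : ℕ} [NeZero N]
variable (θ : Stage13HParams F N) (p : B12.RunParams)

/-- the `hε3` constant at `d = 4`: `143·((d+4)²∕4)² = 36608`. [cite: Balaban1985Averaging, Prop. 2 p.26 (bookkeeping)] -/
theorem const143_eq : (143 * (((((F.P p.K).d + 4 : ℕ) : ℝ)) ^ 2 / 4) ^ 2) = 36608 := by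
  rw [T4Family.P_d]; norm_num

/-- **ROW `h3` AT THE SHAPE** (`M₁ = L^j`, `M₂ = r = 1`): from `3·L^j ≤ L·log θ.γ⁻²` and the window (p605914 `h3_of_log`). [cite: Balaban1988Convergent, (2.5) p.255, (2.13) pp.256–257, (2.17) p.257 (bookkeeping)] -/
theorem h3_of_ccmShape {j : ℕ} (hM₁ : θ.ν.M₁ = (F.P p.K).L ^ j) (hM₂ : θ.ν.M₂ = 1) (hr : θ.ν.r = 1) (hγ1 : θ.γ ≤ 1)
    (h3γ : 3 * ((F.P p.K).L : ℝ) ^ j ≤ (F.P p.K).L * Real.log (θ.γ ^ 2)⁻¹) {k : ℕ} (hw : Step.InInterval θ.γ k (gOfRecord₁₃ F N θ.toStage13Params p)) :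
    ∀ i, 1 ≤ i → i ≤ k →
      3 * side (F.P p.K).L θ.ν.M₁ i ≤ cubeSide (F.P p.K).L θ.ν.M₂ (RkOfRecord (F.P p.K).L θ.ν.r (gOfRecord₁₃ F N θ.toStage13Params p i)) i :=
  h3_of_log θ p hγ1 (by rw [hM₁, hM₂, hr]; push_cast; linarith) hw

/-- **ROW `hR` AT THE SHAPE** (`M₂ = r = 1`): from `8L + 3 ≤ L·log θ.γ⁻²` and the window (p605914 `hR_of_log`). [cite: Balaban1988Convergent, (2.5) p.255, (2.17) p.257; Balaban1985Averaging, Prop. 2 p.26 (bookkeeping)] -/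
theorem hR_of_ccmShape (hM₂ : θ.ν.M₂ = 1) (hr : θ.ν.r = 1) (hγ1 : θ.γ ≤ 1)
    (hRγ : ((8 * (F.P p.K).L + 3 : ℕ) : ℝ) ≤ (F.P p.K).L * Real.log (θ.γ ^ 2)⁻¹) {k : ℕ} (hw : Step.InInterval θ.γ k (gOfRecord₁₃ F N θ.toStage13Params p)) :
    ∀ i, 1 ≤ i → i ≤ k → (F.P p.K).L ^ i + (((F.P p.K).d + 4) * (F.P p.K).L + 2) * (∑ l ∈ Finset.range i, (F.P p.K).L ^ l) + 2 ≤
      cubeSide (F.P p.K).L θ.ν.M₂ (RkOfRecord (F.P p.K).L θ.ν.r (gOfRecord₁₃ F N θ.toStage13Params p i)) i :=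
  hR_of_log θ p hγ1 (by rw [hM₂, hr, T4Family.P_d]; push_cast at hRγ ⊢; linarith) hw

/-- **ROW `hε3` AT THE SHAPE** (`p₀ = 1`, `0 < A₀ ≤ 1∕16`): from `θ.γ ≤ e^{−1}`, `36608·θ.γ·log θ.γ⁻² ≤ 16∕3` and the window (p605914 `hε3_of_window`, edge form).
[cite: Balaban1988Convergent, (2.4) p.255; Balaban1985Averaging, Prop. 2 p.26 (bookkeeping)] -/
theorem hε3_of_ccmShape (hp₀ : θ.ν.p₀ = 1) (hA : 0 < θ.ν.A₀) (hA16 : θ.ν.A₀ ≤ 1 / 16) (hγ0 : 0 < θ.γ) (hγe : θ.γ ≤ Real.exp (-1))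
    (h3γ : 36608 * (θ.γ * Real.log (θ.γ ^ 2)⁻¹) ≤ 16 / 3) {k : ℕ} (hw : Step.InInterval θ.γ k (gOfRecord₁₃ F N θ.toStage13Params p)) :
    ∀ i, 1 ≤ i → i ≤ k → (143 * (((((F.P p.K).d + 4 : ℕ) : ℝ)) ^ 2 / 4) ^ 2) * epsOfRecord θ.ν (gOfRecord₁₃ F N θ.toStage13Params p) i ≤ 1 / 3 := by
  have hγ1 : θ.γ ≤ 1 := hγe.trans (by have := Real.exp_lt_one_iff.mpr (by norm_num : (-1 : ℝ) < 0); exact this.le)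
  have hlog0 : 0 ≤ θ.γ * Real.log (θ.γ ^ 2)⁻¹ := mul_nonneg hγ0.le (log_inv_sq_nonneg hγ0 hγ1)
  refine hε3_of_window θ p hA (by rw [hp₀]; exact_mod_cast hγe) hw ?_
  rw [const143_eq, hp₀, pow_one]
  calc (36608 : ℝ) * (θ.γ * (θ.ν.A₀ * Real.log (θ.γ ^ 2)⁻¹)) = 36608 * (θ.γ * Real.log (θ.γ ^ 2)⁻¹) * θ.ν.A₀ := by ring
    _ ≤ 16 / 3 * (1 / 16) := mul_le_mul h3γ hA16 hA.le (by norm_num)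
    _ = 1 / 3 := by norm_num

/-- **ROW `hε2` AT THE SHAPE** (`p₀ = 1`, `0 < A₀ ≤ 1∕16`): from `θ.γ ≤ e^{−1}`, `θ.γ·log θ.γ⁻² ≤ 16·δ_N∕((d+4)L)²` and the window (p605914 `hε2_of_window`, edge form).
[cite: Balaban1988Convergent, (2.4) p.255; Balaban1985Averaging, Prop. 2 p.26 (bookkeeping)] -/
theorem hε2_of_ccmShape (hp₀ : θ.ν.p₀ = 1) (hA : 0 < θ.ν.A₀) (hA16 : θ.ν.A₀ ≤ 1 / 16) (hγe : θ.γ ≤ Real.exp (-1))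
    (h2γ : θ.γ * Real.log (θ.γ ^ 2)⁻¹ ≤ 16 * ExpMeanLog.deltaSU (Fin N) / ((((F.P p.K).d + 4) * (F.P p.K).L : ℕ) : ℝ) ^ 2) {k : ℕ}
    (hw : Step.InInterval θ.γ k (gOfRecord₁₃ F N θ.toStage13Params p)) :
    ∀ i, 1 ≤ i → i ≤ k →
      2 * epsOfRecord θ.ν (gOfRecord₁₃ F N θ.toStage13Params p) i ≤ 2 * ExpMeanLog.deltaSU (Fin N) / ((((F.P p.K).d + 4) * (F.P p.K).L : ℕ) : ℝ) ^ 2 := by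
  have hδ : 0 < ExpMeanLog.deltaSU (Fin N) := ExpMeanLog.deltaSU_pos
  refine hε2_of_window θ p hA (by rw [hp₀]; exact_mod_cast hγe) hw ?_
  rw [hp₀, pow_one]
  calc 2 * (θ.γ * (θ.ν.A₀ * Real.log (θ.γ ^ 2)⁻¹)) = 2 * ((θ.γ * Real.log (θ.γ ^ 2)⁻¹) * θ.ν.A₀) := by ring
    _ ≤ 2 * ((16 * ExpMeanLog.deltaSU (Fin N) / ((((F.P p.K).d + 4) * (F.P p.K).L : ℕ) : ℝ) ^ 2) * (1 / 16)) := by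
        have h := mul_le_mul h2γ hA16 hA.le (by positivity : (0 : ℝ) ≤ 16 * ExpMeanLog.deltaSU (Fin N) / ((((F.P p.K).d + 4) * (F.P p.K).L : ℕ) : ℝ) ^ 2)
        linarith
    _ = 2 * ExpMeanLog.deltaSU (Fin N) / ((((F.P p.K).d + 4) * (F.P p.K).L : ℕ) : ℝ) ^ 2 := by ring

end Shape

/-! ## §3  At the H-extensions of K1's witness of record `θ₁₅ᶜᶜᴹᵂ(j; γ)`: the five rows from the four γ-conditions, and the explicit window -/

section AtWitness

variable {F : T4Family} {N : ℕ} [NeZero N]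
variable {Zr : (q : B12.RunParams) → TkResidualW F N (FluctV N) q.K}
  {Zh : (q : B12.RunParams) → ℕ → (ℕ → Set (Site (F.P q.K) 0)) → (ℕ → Set (Site (F.P q.K) 0)) → TkResidualW F N (FluctV N) q.K}
  {Phih : (q : B12.RunParams) → ℕ → (ℕ → Set (Site (F.P q.K) 0)) → (ℕ → Set (Site (F.P q.K) 0)) → (ℕ → Plaq (F.P q.K) 0 → ℝ)}
variable {j : ℕ} {γ ε₀ ε₂₉ B₃ B₃' a₀ a₁ : ℝ}

/-- **★★ THE FIVE NUMERIC ROWS OF N11's NO-EXPANSION 𝐓-STEP AT EVERY H-EXTENSION `⟨⟨θ₁₅ᶜᶜᴹᵂ(j; γ), Zr⟩, Zh, Phih⟩` OF K1's WITNESS OF RECORD, ON EVERY RUN IN THE WINDOW `]0, γ]`,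
EVERY LEVEL, FROM THE FOUR γ-CONDITIONS** (`γ ≤ e^{−1}`, `3·L^j ≤ L·log γ⁻²`, `8L + 3 ≤ L·log γ⁻²`, `36608·γ·log γ⁻² ≤ 16∕3`, `γ·log γ⁻² ≤ 16·δ_N∕(8L)²`) and [15]'s signs
(`0 < A₀ᶜᶜ¹ ≤ 1∕16`).  Conclusions VERBATIM the binders `h3 hR hε hε3 hε2` of dag-n11-d's p604229 ∕ p605244 at this parameter (every shape field `rfl`).
[cite: Balaban1988Convergent, (2.4)–(2.5) p.255, (2.13) pp.256–257, (2.17) p.257; Balaban1985Averaging, Prop. 2 p.26; Balaban1987RG1, Thm 1 p.259; Balaban1985Variational, (7) p.278, Thm 1 (8)–(10) p.279 (bookkeeping)] -/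
theorem numericRows_theta13OfThm1CCMWH (hB : 0 ≤ B₃) (hB' : 0 ≤ B₃') (ha₀ : 0 < a₀) (ha₁ : 0 < a₁) (hγ0 : 0 < γ) (hγe : γ ≤ Real.exp (-1))
    (h3γ : 3 * (F.L : ℝ) ^ j ≤ F.L * Real.log (γ ^ 2)⁻¹) (hRγ : ((8 * F.L + 3 : ℕ) : ℝ) ≤ F.L * Real.log (γ ^ 2)⁻¹)
    (hε3γ : 36608 * (γ * Real.log (γ ^ 2)⁻¹) ≤ 16 / 3) (hε2γ : γ * Real.log (γ ^ 2)⁻¹ ≤ 16 * ExpMeanLog.deltaSU (Fin N) / ((8 * F.L : ℕ) : ℝ) ^ 2)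
    (p : B12.RunParams) {k : ℕ} (hw : Step.InInterval γ k (gOfRecord₁₃ F N (theta13OfThm1CCMW F N j γ ε₀ ε₂₉ B₃ B₃' a₀ a₁) p)) :
      (∀ i, 1 ≤ i → i ≤ k →
          3 * side (F.P p.K).L (⟨⟨theta13OfThm1CCMW F N j γ ε₀ ε₂₉ B₃ B₃' a₀ a₁, Zr⟩, Zh, Phih⟩ : Stage13HParams F N).ν.M₁ i ≤
            cubeSide (F.P p.K).L (⟨⟨theta13OfThm1CCMW F N j γ ε₀ ε₂₉ B₃ B₃' a₀ a₁, Zr⟩, Zh, Phih⟩ : Stage13HParams F N).ν.M₂ (RkOfRecord (F.P p.K).L (⟨⟨theta13OfThm1CCMW F N j γ ε₀ ε₂₉ B₃ B₃' a₀ a₁, Zr⟩, Zh, Phih⟩ : Stage13HParams F N).ν.r (gOfRecord₁₃ F N (⟨⟨theta13OfThm1CCMW F N j γ ε₀ ε₂₉ B₃ B₃' a₀ a₁, Zr⟩, Zh, Phih⟩ : Stage13HParams F N).toStage13Params p i)) i) ∧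
      (∀ i, 1 ≤ i → i ≤ k → (F.P p.K).L ^ i + (((F.P p.K).d + 4) * (F.P p.K).L + 2) * (∑ l ∈ Finset.range i, (F.P p.K).L ^ l) + 2 ≤
          cubeSide (F.P p.K).L (⟨⟨theta13OfThm1CCMW F N j γ ε₀ ε₂₉ B₃ B₃' a₀ a₁, Zr⟩, Zh, Phih⟩ : Stage13HParams F N).ν.M₂ (RkOfRecord (F.P p.K).L (⟨⟨theta13OfThm1CCMW F N j γ ε₀ ε₂₉ B₃ B₃' a₀ a₁, Zr⟩, Zh, Phih⟩ : Stage13HParams F N).ν.r (gOfRecord₁₃ F N (⟨⟨theta13OfThm1CCMW F N j γ ε₀ ε₂₉ B₃ B₃' a₀ a₁, Zr⟩, Zh, Phih⟩ : Stage13HParams F N).toStage13Params p i)) i) ∧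
      (∀ i, 1 ≤ i → i ≤ k → 0 < epsOfRecord (⟨⟨theta13OfThm1CCMW F N j γ ε₀ ε₂₉ B₃ B₃' a₀ a₁, Zr⟩, Zh, Phih⟩ : Stage13HParams F N).ν (gOfRecord₁₃ F N (⟨⟨theta13OfThm1CCMW F N j γ ε₀ ε₂₉ B₃ B₃' a₀ a₁, Zr⟩, Zh, Phih⟩ : Stage13HParams F N).toStage13Params p) i) ∧
      (∀ i, 1 ≤ i → i ≤ k → (143 * (((((F.P p.K).d + 4 : ℕ) : ℝ)) ^ 2 / 4) ^ 2) * epsOfRecord (⟨⟨theta13OfThm1CCMW F N j γ ε₀ ε₂₉ B₃ B₃' a₀ a₁, Zr⟩, Zh, Phih⟩ : Stage13HParams F N).ν (gOfRecord₁₃ F N (⟨⟨theta13OfThm1CCMW F N j γ ε₀ ε₂₉ B₃ B₃' a₀ a₁, Zr⟩, Zh, Phih⟩ : Stage13HParams F N).toStage13Params p) i ≤ 1 / 3) ∧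
      (∀ i, 1 ≤ i → i ≤ k → 2 * epsOfRecord (⟨⟨theta13OfThm1CCMW F N j γ ε₀ ε₂₉ B₃ B₃' a₀ a₁, Zr⟩, Zh, Phih⟩ : Stage13HParams F N).ν (gOfRecord₁₃ F N (⟨⟨theta13OfThm1CCMW F N j γ ε₀ ε₂₉ B₃ B₃' a₀ a₁, Zr⟩, Zh, Phih⟩ : Stage13HParams F N).toStage13Params p) i ≤
          2 * ExpMeanLog.deltaSU (Fin N) / ((((F.P p.K).d + 4) * (F.P p.K).L : ℕ) : ℝ) ^ 2) := by
  have hγ1 : γ ≤ 1 := hγe.trans (Real.exp_lt_one_iff.mpr (by norm_num : (-1 : ℝ) < 0)).le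
  have hA : 0 < (⟨⟨theta13OfThm1CCMW F N j γ ε₀ ε₂₉ B₃ B₃' a₀ a₁, Zr⟩, Zh, Phih⟩ : Stage13HParams F N).ν.A₀ := A0OfThm1CC1_pos hB hB' ha₀ ha₁
  have hA16 : (⟨⟨theta13OfThm1CCMW F N j γ ε₀ ε₂₉ B₃ B₃' a₀ a₁, Zr⟩, Zh, Phih⟩ : Stage13HParams F N).ν.A₀ ≤ 1 / 16 := A0OfThm1CC1_le_one_div_sixteen hB hB' ha₀.le ha₁.le
  have hw' : Step.InInterval (⟨⟨theta13OfThm1CCMW F N j γ ε₀ ε₂₉ B₃ B₃' a₀ a₁, Zr⟩, Zh, Phih⟩ : Stage13HParams F N).γ k (gOfRecord₁₃ F N (⟨⟨theta13OfThm1CCMW F N j γ ε₀ ε₂₉ B₃ B₃' a₀ a₁, Zr⟩, Zh, Phih⟩ : Stage13HParams F N).toStage13Params p) := hw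
  refine ⟨h3_of_ccmShape _ p rfl rfl rfl hγ1 h3γ hw', hR_of_ccmShape _ p rfl rfl hγ1 ?_ hw', hε_of_window _ p hA (hγe.trans_lt (Real.exp_lt_one_iff.mpr (by norm_num))) hw',
    hε3_of_ccmShape _ p rfl hA hA16 hγ0 hγe hε3γ hw', hε2_of_ccmShape _ p rfl hA hA16 hγe ?_ hw'⟩
  · show ((8 * (F.P p.K).L + 3 : ℕ) : ℝ) ≤ (F.P p.K).L * Real.log (γ ^ 2)⁻¹
    rw [T4Family.P_L]; exact hRγ
  · show γ * Real.log (γ ^ 2)⁻¹ ≤ 16 * ExpMeanLog.deltaSU (Fin N) / ((((F.P p.K).d + 4) * (F.P p.K).L : ℕ) : ℝ) ^ 2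
    rw [T4Family.P_d, T4Family.P_L]; exact hε2γ

/-- **★★★ «γ SUFFICIENTLY SMALL» FOR N11's NUMERIC ROWS AT K1's WITNESS OF RECORD, QUANTIFIED**: there is an explicit `γ₁₁ⁿᵘᵐ(L, j, N) > 0` (§1) such that for EVERY window letter
`γ ∈ ]0, γ₁₁ⁿᵘᵐ]`, at every H-extension of `θ₁₅ᶜᶜᴹᵂ(j; γ)`, on every run in the window `]0, γ]` and every level, the five numeric rows `h3 hR hε hε3 hε2` of dag-n11-d's ZhPin-class
no-expansion 𝐓-step hold ([15]'s signs on `B₃, B₃′, a₀, a₁` only).  LOCATED (not touched here): the row `2 ≤ cR` is FALSE at `θ₁₅ᶜᶜᴹᵂ` (`cR = 1`).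
[cite: Balaban1988Convergent, (2.4)–(2.5) p.255, (2.13) pp.256–257, (2.17) p.257; Balaban1985Averaging, Prop. 2 p.26; Balaban1987RG1, Thm 1 p.259; Balaban1985Variational, (7) p.278, Thm 1 (8)–(10) p.279 (bookkeeping)] -/
theorem exists_window_numericRows_theta13OfThm1CCMWH (F : T4Family) (N : ℕ) [NeZero N] (j : ℕ) :
    ∃ γ₀ : ℝ, 0 < γ₀ ∧ ∀ (γ ε₀ ε₂₉ B₃ B₃' a₀ a₁ : ℝ), 0 ≤ B₃ → 0 ≤ B₃' → 0 < a₀ → 0 < a₁ → 0 < γ → γ ≤ γ₀ →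
      ∀ (Zr : (q : B12.RunParams) → TkResidualW F N (FluctV N) q.K)
        (Zh : (q : B12.RunParams) → ℕ → (ℕ → Set (Site (F.P q.K) 0)) → (ℕ → Set (Site (F.P q.K) 0)) → TkResidualW F N (FluctV N) q.K)
        (Phih : (q : B12.RunParams) → ℕ → (ℕ → Set (Site (F.P q.K) 0)) → (ℕ → Set (Site (F.P q.K) 0)) → (ℕ → Plaq (F.P q.K) 0 → ℝ))
        (p : B12.RunParams) (k : ℕ), Step.InInterval γ k (gOfRecord₁₃ F N (theta13OfThm1CCMW F N j γ ε₀ ε₂₉ B₃ B₃' a₀ a₁) p) →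
      (∀ i, 1 ≤ i → i ≤ k →
          3 * side (F.P p.K).L (⟨⟨theta13OfThm1CCMW F N j γ ε₀ ε₂₉ B₃ B₃' a₀ a₁, Zr⟩, Zh, Phih⟩ : Stage13HParams F N).ν.M₁ i ≤
            cubeSide (F.P p.K).L (⟨⟨theta13OfThm1CCMW F N j γ ε₀ ε₂₉ B₃ B₃' a₀ a₁, Zr⟩, Zh, Phih⟩ : Stage13HParams F N).ν.M₂ (RkOfRecord (F.P p.K).L (⟨⟨theta13OfThm1CCMW F N j γ ε₀ ε₂₉ B₃ B₃' a₀ a₁, Zr⟩, Zh, Phih⟩ : Stage13HParams F N).ν.r (gOfRecord₁₃ F N (⟨⟨theta13OfThm1CCMW F N j γ ε₀ ε₂₉ B₃ B₃' a₀ a₁, Zr⟩, Zh, Phih⟩ : Stage13HParams F N).toStage13Params p i)) i) ∧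
      (∀ i, 1 ≤ i → i ≤ k → (F.P p.K).L ^ i + (((F.P p.K).d + 4) * (F.P p.K).L + 2) * (∑ l ∈ Finset.range i, (F.P p.K).L ^ l) + 2 ≤
          cubeSide (F.P p.K).L (⟨⟨theta13OfThm1CCMW F N j γ ε₀ ε₂₉ B₃ B₃' a₀ a₁, Zr⟩, Zh, Phih⟩ : Stage13HParams F N).ν.M₂ (RkOfRecord (F.P p.K).L (⟨⟨theta13OfThm1CCMW F N j γ ε₀ ε₂₉ B₃ B₃' a₀ a₁, Zr⟩, Zh, Phih⟩ : Stage13HParams F N).ν.r (gOfRecord₁₃ F N (⟨⟨theta13OfThm1CCMW F N j γ ε₀ ε₂₉ B₃ B₃' a₀ a₁, Zr⟩, Zh, Phih⟩ : Stage13HParams F N).toStage13Params p i)) i) ∧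
      (∀ i, 1 ≤ i → i ≤ k → 0 < epsOfRecord (⟨⟨theta13OfThm1CCMW F N j γ ε₀ ε₂₉ B₃ B₃' a₀ a₁, Zr⟩, Zh, Phih⟩ : Stage13HParams F N).ν (gOfRecord₁₃ F N (⟨⟨theta13OfThm1CCMW F N j γ ε₀ ε₂₉ B₃ B₃' a₀ a₁, Zr⟩, Zh, Phih⟩ : Stage13HParams F N).toStage13Params p) i) ∧
      (∀ i, 1 ≤ i → i ≤ k → (143 * (((((F.P p.K).d + 4 : ℕ) : ℝ)) ^ 2 / 4) ^ 2) * epsOfRecord (⟨⟨theta13OfThm1CCMW F N j γ ε₀ ε₂₉ B₃ B₃' a₀ a₁, Zr⟩, Zh, Phih⟩ : Stage13HParams F N).ν (gOfRecord₁₃ F N (⟨⟨theta13OfThm1CCMW F N j γ ε₀ ε₂₉ B₃ B₃' a₀ a₁, Zr⟩, Zh, Phih⟩ : Stage13HParams F N).toStage13Params p) i ≤ 1 / 3) ∧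
      (∀ i, 1 ≤ i → i ≤ k → 2 * epsOfRecord (⟨⟨theta13OfThm1CCMW F N j γ ε₀ ε₂₉ B₃ B₃' a₀ a₁, Zr⟩, Zh, Phih⟩ : Stage13HParams F N).ν (gOfRecord₁₃ F N (⟨⟨theta13OfThm1CCMW F N j γ ε₀ ε₂₉ B₃ B₃' a₀ a₁, Zr⟩, Zh, Phih⟩ : Stage13HParams F N).toStage13Params p) i ≤
          2 * ExpMeanLog.deltaSU (Fin N) / ((((F.P p.K).d + 4) * (F.P p.K).L : ℕ) : ℝ) ^ 2) := by
  obtain ⟨γ₀, hγ₀, hall⟩ := exists_window_ccmShape (L := F.L) (by have := F.hL11; omega) j N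
  refine ⟨γ₀, hγ₀, fun γ ε₀ ε₂₉ B₃ B₃' a₀ a₁ hB hB' ha₀ ha₁ hγ hγle Zr Zh Phih p k hw => ?_⟩
  obtain ⟨hγe, h3γ, hRγ, hε3γ, hε2γ⟩ := hall γ hγ hγle
  exact numericRows_theta13OfThm1CCMWH hB hB' ha₀ ha₁ hγ hγe h3γ hRγ hε3γ hε2γ p hw

end AtWitness

end Summit.QuantumFields.YangMills.Theorems.BalabanUVNodesN11NoExpansionNumericsAtThm1CCMW

end
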